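import Summits.ABC.IUTFork.Joshi.LogLinkFrobeniusTransport

/-!
# [J-IIp] Thm. 10.15.1 (3): the reading fork (R-ϕ)/(R-fix) of `LogLinkFrobeniusTransport` COLLAPSES in kernel —
# under §10.13's Frobenius transport, the common-target form of (3) fails for EVERY identification with `ℂ_p`,
# and reading (R-fix) is itself inconsistent with §10.13 + §10.5 (located, not adjudicated)

Proof-only companion (abc-iut cell, block E «type Joshi's construction, test vs S», rung LADDER-ABC:A2.E; seat abc-iut-E-t7,
gen 2 — AUTHORS-FIRST derivable item on this seat's own `Joshi/LogLinkFrobeniusTransport.lean`, p430819) answering the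
item left open by the typer-side read of E-t52's non-vacuity model `Joshi/LogLinkColumnModel.lean` (p434703; E-t48
2026-08-26T09:32:44Z INFO 1: «a model where the identification is a non-trivial automorphism would be the (R-fix) side's
business (E-t7's fork), correctly left open»). It needs NO model: it closes over the signature. Source: K. Joshi,
arXiv:2303.01662v3 (`paper:arxiv-2303.01662`; bib `Joshi2023ATS2Local`; unrefereed — TYPED AS A CANDIDATE), §10.13–§10.15,
render `HOME/lit/renders/Joshi-arxiv-2303.01662/p0033.txt` («p.33 l.M»). TAKES NO SIDE on [IUTchIII] Cor. 3.12, on Joshi's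
claims, or on Mochizuki's report on them; typed ≠ proved; a located item is NOT a verdict on any author. Object-side file
(E-PLAN R14: no `Cor312*`/`Thm311*` import). No FACT-LIST row consumed; 0 new `def`s; nothing asserted.

PRINT. Thm. 10.15.1 (3) (p.33 l.66–68): «There is no continuous field isomorphism `ℂ_p = K_{y_{n−1}} ≃ K_{x_can} → K_{y_n} ≃
K_{x_can} = ℂ_p` which may be inserted into the middle row of the diagram so that each resulting square commutes»; proof
(l.75–77): «`ℂ_p` cannot be equipped with any field homomorphism of the sort `x ↦ x^p` which would be forced by commutativity».
§10.13 (p.33 l.1–12): `ϕ(𝔪_{y_{n−1}}) = 𝔪_{y_n}` (typed by p430819 as the HYPOTHESIS structure `FrobeniusTransport D y`, from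
which `residueIso : K_y ≃+* K_{ϕ(y)}` with `residueIso (η_y b) = η_{ϕ(y)} (ϕ b)` is CONSTRUCTED). §10.5 (p.31 l.40–45): the
logarithm `B^{φ=p} → K` is surjective (here only: it hits `1`).

WHAT p430819 RECORDED: the common-target form `NoInsertedIso I` of (3) (both residue fields identified with one field `C` =
«`K_{x_can} = ℂ_p`» by a `CommonTarget` `I = (iso₀, iso₁)`) HOLDS in reading (R-fix) (`LogsCoincide`: the two logarithms are
literally the same map) given «log hits 1» (`noInsertedIso_of_logsCoincide` — Joshi's `τ(1) = p` argument), FAILS in reading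
(R-ϕ) (`FrobCompatible`: identifications transported along `ϕ`; `not_noInsertedIso_of_frobCompatible`, `τ = id`), and the two
readings are jointly inconsistent (`logsCoincide_frobCompatible_absurd`).

WHAT THIS FILE ADDS (kernel, over the same explicit hypotheses).
* `exists_insertedIso_of_transport` / **`not_noInsertedIso_of_transport`**: given a §10.13 transport `T` at `y`, for EVERY
  common target `I` the ring automorphism `τ := iso₁ ∘ σ_y ∘ iso₀⁻¹` of `C` makes every square commute — on all of `B`, not only
  on `B^{φ=p}` — so the typed (3) FAILS for every choice of the identifications `K_{y_{n−1}} ≃ ℂ_p`, `K_{y_n} ≃ ℂ_p`, not only for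
  the ϕ-transported ones: the hypothesis `FrobCompatible` of p430819's negative half is IDLE.
* **`logsCoincide_absurd_of_transport`** / `not_logsCoincide_of_transport`: reading (R-fix) together with «the logarithm of
  `ϕ(y)` hits `1`» and `p ≠ 1` in `C` is INCONSISTENT with the existence of a §10.13 transport (no `FrobCompatible` needed):
  `σ_y (η_y b) = p · η_{ϕ(y)} b = p` forces `η_y b = p`, and coincidence of the logarithms then reads `p = 1` in `C`. So the
  positive half of the fork proves (3) from premises that contradict §10.13 + §10.5 as typed.
* `insertedIso_unique_on_logs`: any inserted `τ` agrees with `iso₁ ∘ σ_y ∘ iso₀⁻¹` on the image of `log₀` — the inserted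
  isomorphism is determined on the log-shell; in particular under (R-ϕ) it is the identity there (`insertedIso_eq_self_of_frobCompatible`).
LOCATED SENTENCE (no side taken): «Over the period-ring signature, §10.13's own transport `σ_y` refutes Thm. 10.15.1 (3) in
BOTH typed forms — E-t3's middle-row form (`not_noCommutingFieldIso_of_transport`, p430819) and the common-target form for every
identification with `ℂ_p` (this file) — and the reading under which print's proof goes through, (R-fix), contradicts §10.13 +
§10.5. What the typing does not model is CONTINUITY (no topology in the signature): print's (3) excludes continuous `τ` only;
whether `σ_y` (induced by the ring automorphism `ϕ` of `B`, [FF18]) and the natural identifications are continuous is the one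
escape route left to print, recorded for the faithfulness lane (E-ref-2 / E-ref), not adjudicated here.» Non-vacuity of the
hypotheses (`FrobeniusTransport` at every point of a two-sided Frobenius column with `B^{φ=p} ≠ 0` and log hitting `1`): E-t52's
`Summit.ABC.IUTFork.Joshi.ColumnModel.transport` / `.hone` / `.rphi_horn_nonvacuous` (p434703), cited BY NAME, not imported.
-/

noncomputable section

namespace Summit.ABC.IUTFork.Joshi

namespace PeriodRingDatum

variable {F B E0 : Type} [Field F] [CommRing B] [Field E0] {Y : Type} {K : Y → Type} [∀ y, Field (K y)] {G : Type}
  {D : PeriodRingDatum F B E0 Y K G} {C : Type} [Field C]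

/-! ## 1. Under §10.13's transport an inserted isomorphism EXISTS, for every common target -/

/-- **The square commutes with `τ := iso₁ ∘ σ_y ∘ iso₀⁻¹` inserted** — for EVERY common target `I` and on ALL of `B`:
`τ (iso₀ (η_y b)) = iso₁ (σ_y (η_y b)) = iso₁ (η_{ϕ(y)} (ϕ b))` by p430819's `residueIso_eta`. The identifications with `C` conjugate
the problem; they cannot create or destroy an inserted isomorphism. [claim: Joshi2023ATS2Local, status: disputed] -/
theorem exists_insertedIso_of_transport {y : Y} (T : D.FrobeniusTransport y) (I : D.CommonTarget C y) :
    ∃ τ : C ≃+* C, ∀ b : B, τ (I.log₀ b) = I.log₁ (D.frob b) :=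
  ⟨I.iso₀.symm.trans (T.residueIso.trans I.iso₁), fun b => by
    simp only [CommonTarget.log₀, CommonTarget.log₁, RingEquiv.trans_apply, RingEquiv.symm_apply_apply,
      T.residueIso_eta]⟩

/-- **Thm. 10.15.1 (3), common-target form, FAILS under §10.13's transport for EVERY identification** `K_{y_{n−1}} ≃ C`,
`K_{y_n} ≃ C` (p.33 l.66–68 vs l.1–12): the hypothesis `FrobCompatible` of p430819's `not_noInsertedIso_of_frobCompatible` is idle.
Typed over all ring automorphisms of `C` (continuity not modelled — see the module docstring for what that leaves to print).
Located, not adjudicated. [claim: Joshi2023ATS2Local, status: disputed] -/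
theorem not_noInsertedIso_of_transport {y : Y} (T : D.FrobeniusTransport y) (I : D.CommonTarget C y) :
    ¬ NoInsertedIso I := by
  intro h
  obtain ⟨τ, hτ⟩ := exists_insertedIso_of_transport T I
  exact h ⟨τ, fun b _ => hτ b⟩

/-- Any inserted `τ` is DETERMINED on the image of `log₀`: it agrees there with `iso₁ ∘ σ_y ∘ iso₀⁻¹`. [folklore] -/
theorem insertedIso_unique_on_logs {y : Y} (T : D.FrobeniusTransport y) (I : D.CommonTarget C y) {τ : C ≃+* C}
    (hτ : ∀ b ∈ D.Bphi, τ (I.log₀ b) = I.log₁ (D.frob b)) {b : B} (hb : b ∈ D.Bphi) :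
    τ (I.log₀ b) = I.iso₁ (T.residueIso (I.iso₀.symm (I.log₀ b))) := by
  rw [hτ b hb]
  simp only [CommonTarget.log₀, CommonTarget.log₁, RingEquiv.symm_apply_apply, T.residueIso_eta]

/-- … in particular, in reading (R-ϕ) every inserted `τ` is the IDENTITY on the log-shell `log₀(B^{φ=p})`. [claim: Joshi2023ATS2Local, status: disputed] -/
theorem insertedIso_eq_self_of_frobCompatible {y : Y} (T : D.FrobeniusTransport y) (I : D.CommonTarget C y)
    (hI : FrobCompatible T I) {τ : C ≃+* C} (hτ : ∀ b ∈ D.Bphi, τ (I.log₀ b) = I.log₁ (D.frob b)) {b : B}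
    (hb : b ∈ D.Bphi) : τ (I.log₀ b) = I.log₀ b := by
  rw [insertedIso_unique_on_logs T I hτ hb, hI]
  simp only [CommonTarget.log₀, RingEquiv.apply_symm_apply]

/-! ## 2. Reading (R-fix) is inconsistent with §10.13 + «log hits 1» -/

/-- Under the transport, a `b ∈ B^{φ=p}` whose logarithm at `ϕ(y)` is `1` has logarithm `p` at `y`:
`σ_y (η_y b) = p · η_{ϕ(y)} b = p = σ_y p`. [claim: Joshi2023ATS2Local, status: disputed] -/
theorem eta_eq_p_of_eta_frobY_eq_one {y : Y} (T : D.FrobeniusTransport y) {b : B} (hb : b ∈ D.Bphi)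
    (hb1 : D.eta (D.frobY y) b = 1) : D.eta y b = (D.p : K y) := by
  apply T.residueIso.injective
  rw [D.residueIso_eta_of_mem_Bphi T hb, hb1, mul_one, map_natCast]

/-- **(R-fix) + «the logarithm of `ϕ(y)` hits `1`» + `p ≠ 1` in `C` CONTRADICT the existence of a §10.13 transport** — no
`FrobCompatible` hypothesis (sharpens p430819's `logsCoincide_frobCompatible_absurd`): coincidence of the logarithms at such a `b`
reads `iso₀ p = iso₁ 1`, i.e. `p = 1` in `C`. So the reading under which print's proof of (3) goes through is not available
together with §10.13 and §10.5 as typed. Located, not adjudicated. [claim: Joshi2023ATS2Local, status: disputed] -/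
theorem logsCoincide_absurd_of_transport {y : Y} (T : D.FrobeniusTransport y) (I : D.CommonTarget C y)
    (hfix : LogsCoincide I) (hone : ∃ b ∈ D.Bphi, D.eta (D.frobY y) b = 1) (hp : (D.p : C) ≠ 1) : False := by
  obtain ⟨b, hb, hb1⟩ := hone
  have h := hfix b hb
  simp only [CommonTarget.log₀, CommonTarget.log₁, eta_eq_p_of_eta_frobY_eq_one T hb hb1, hb1, map_natCast,
    map_one] at h
  exact hp h

/-- Equivalently: under a §10.13 transport with the logarithm of `ϕ(y)` hitting `1` and `p ≠ 1` in `C`, the logarithms do NOT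
coincide — reading (R-fix) is refuted wherever reading (R-ϕ)'s INPUT (the transport) exists, whatever the identifications.
[claim: Joshi2023ATS2Local, status: disputed] -/
theorem not_logsCoincide_of_transport {y : Y} (T : D.FrobeniusTransport y) (I : D.CommonTarget C y)
    (hone : ∃ b ∈ D.Bphi, D.eta (D.frobY y) b = 1) (hp : (D.p : C) ≠ 1) : ¬ LogsCoincide I :=
  fun hfix => logsCoincide_absurd_of_transport T I hfix hone hp

/-- The same with «log hits 1» at the OTHER end (`η_y b = 1` for some `b ∈ B^{φ=p}`; then `η_{ϕ(y)} b = p⁻¹`-shaped: `p · η_{ϕ(y)} b = 1`):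
coincidence reads `1 = iso₁ (η_{ϕ(y)} b)` with `p · iso₁ (η_{ϕ(y)} b) = 1`, i.e. `p = 1` in `C`. [claim: Joshi2023ATS2Local, status: disputed] -/
theorem logsCoincide_absurd_of_transport' {y : Y} (T : D.FrobeniusTransport y) (I : D.CommonTarget C y)
    (hfix : LogsCoincide I) (hone : ∃ b ∈ D.Bphi, D.eta y b = 1) (hp : (D.p : C) ≠ 1) : False := by
  obtain ⟨b, hb, hb1⟩ := hone
  have h1 : (D.p : K (D.frobY y)) * D.eta (D.frobY y) b = 1 := by
    rw [← D.residueIso_eta_of_mem_Bphi T hb, hb1, map_one]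
  have h := hfix b hb
  simp only [CommonTarget.log₀, CommonTarget.log₁, hb1, map_one] at h
  have h2 : (D.p : C) * I.iso₁ (D.eta (D.frobY y) b) = 1 := by
    rw [← map_natCast I.iso₁ D.p, ← map_mul, h1, map_one]
  rw [← h, mul_one] at h2
  exact hp h2

end PeriodRingDatum

end Summit.ABC.IUTFork.Joshi

end
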